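import Mathlib
import HarnessLib
import Summits.QuantumFields.YangMills.Theorems.MirrorModularBoostsHypercubicLimitPlaneLimitsDefs
import Summits.QuantumFields.YangMills.Theorems.LangevinControlUVOSLegsFromFemtoAndGapStubAssemblyInheritance
import Summits.QuantumFields.YangMills.Theorems.MirrorModularBoostsHypercubicLimitTranslationPlanesSeam
import Literature.MathematicalPhysics.QuantumFieldTheory.SchwingerLimitInheritance
import Literature.MathematicalPhysics.QuantumFieldTheory.LatticeGaugeProofs

/-!
# Line `Sketch` (coupling response), Z3a residual: translation invariance on `⁰𝒮` of the plane-string limits along `φ → ∞`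

Helper file for stub `stub_translationPlanes` of crux `stmt-QuantumFields-16154` (`HypercubicLimit`), line `Sketch`;
registered sub-goal `translationPlanes_of_tendsto`.  Along a `PlaneLimits` package `(φ, T)` of a scheme with polynomial
volume growth (`PolyVolume`) and polynomial renormalisation (`PolyRenorm`) obeying the uniform functional bound
(`UniformFunctionalBoundPlanes`), the candidate family `planeSum T` is invariant under ALL translations of `ℝ⁴` on `⁰𝒮`
— PROVIDED the package is taken along `φ → ∞` (e.g. `StrictMono φ`, as the compactness step `stub_planeLimits` delivers
it; for a constant `φ` the limits are finite lattice sums and the claim fails).  Route (tree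
`translateMulti_apply_eq_of_tendsto`): lattice vectors `b_j = a_{φ j} ⌊a / a_{φ j}⌋ → a`; uniform bound =
`UniformFunctionalBoundPlanes` summed over the `6ⁿ` strings; asymptotic invariance = the seam estimate
`norm_planeDist_translate_sub_le` (seam file) + the bookkeeping `seam_arith`, `o(1)` because `a_k L_k → ∞` and every power
of `a_k⁻¹` is a power of `a_k L_k` (`PolyVolume`).
-/

noncomputable section

open scoped SchwartzMap BigOperators
open MeasureTheory Filter Topology
open Literature.MathematicalPhysics.AQFT Literature.MathematicalPhysics.QuantumLattice
  Literature.MathematicalPhysics.QuantumFieldTheory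
open Literature.Probability.LatticeModels (box Site mem_box zero_mem_box)
open Summit.QuantumFields.YangMills.Theorems.OSLegsFromFemtoAndGap

namespace Summit.QuantumFields.YangMills.Cruxes.HypercubicLimit.CouplingResponse

/-- **Seam bookkeeping** (pure real arithmetic): with `X = a L ≥ 1`, `a ≤ 1`, `a⁻¹ ≤ X^{N₀}` and the order
`p = (N₀+1)·4n + N₀·Q·n + 1`, the bound `2 (2L+1)^{4n} (K a^{-Q})ⁿ B / (a L/2)^p` is at most `2·3^{4n} Kⁿ 2^p B / X`.
[folklore] -/
theorem seam_arith {a X K B : ℝ} {L N₀ Q n : ℕ} (ha : 0 < a) (hX : X = a * L) (hX1 : 1 ≤ X)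
    (hvol : a⁻¹ ≤ X ^ N₀) (hK : 0 ≤ K) (hB : 0 ≤ B) :
    2 * ((2 * L + 1 : ℕ) : ℝ) ^ (4 * n) *
        ((K * a⁻¹ ^ Q) ^ n * (B / (a * L / 2) ^ ((N₀ + 1) * (4 * n) + N₀ * (Q * n) + 1))) ≤
      2 * 3 ^ (4 * n) * K ^ n * 2 ^ ((N₀ + 1) * (4 * n) + N₀ * (Q * n) + 1) * B / X := by
  -- adapted from `ContinuumLimitOnTrajectory.TwoOrbitSynchronisation.Transl.seam_bookkeeping`
  set E : ℕ := (N₀ + 1) * (4 * n) + N₀ * (Q * n) with hE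
  have hXpos : 0 < X := by linarith
  have hY1 : 1 ≤ X ^ (N₀ + 1) := one_le_pow₀ hX1
  have hLX : (L : ℝ) = X * a⁻¹ := by rw [hX]; field_simp
  have hXa : X * a⁻¹ ≤ X ^ (N₀ + 1) := by
    rw [pow_succ']
    exact mul_le_mul_of_nonneg_left hvol hXpos.le
  have h2L : ((2 * L + 1 : ℕ) : ℝ) ≤ 3 * X ^ (N₀ + 1) := by push_cast; rw [hLX]; nlinarith
  -- the three factors against powers of `X`
  have hbox : ((2 * L + 1 : ℕ) : ℝ) ^ (4 * n) ≤ 3 ^ (4 * n) * X ^ ((N₀ + 1) * (4 * n)) :=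
    calc ((2 * L + 1 : ℕ) : ℝ) ^ (4 * n) ≤ (3 * X ^ (N₀ + 1)) ^ (4 * n) :=
          pow_le_pow_left₀ (by positivity) h2L _
      _ = 3 ^ (4 * n) * X ^ ((N₀ + 1) * (4 * n)) := by rw [mul_pow, ← pow_mul]
  have hren : (K * a⁻¹ ^ Q) ^ n ≤ K ^ n * X ^ (N₀ * (Q * n)) :=
    calc (K * a⁻¹ ^ Q) ^ n = K ^ n * a⁻¹ ^ (Q * n) := by rw [mul_pow, ← pow_mul]
      _ ≤ K ^ n * (X ^ N₀) ^ (Q * n) := by gcongr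
      _ = K ^ n * X ^ (N₀ * (Q * n)) := by rw [← pow_mul]
  have htail : B / (a * L / 2) ^ (E + 1) = 2 ^ (E + 1) * B / X ^ (E + 1) := by
    rw [← hX, div_pow]
    field_simp
  rw [htail]
  have hXE : X ^ ((N₀ + 1) * (4 * n)) * X ^ (N₀ * (Q * n)) = X ^ E := by rw [← pow_add]
  have hquot : X ^ E / X ^ (E + 1) = X⁻¹ := by
    rw [pow_succ]
    field_simp
  calc 2 * ((2 * L + 1 : ℕ) : ℝ) ^ (4 * n) * ((K * a⁻¹ ^ Q) ^ n * (2 ^ (E + 1) * B / X ^ (E + 1)))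
      ≤ 2 * (3 ^ (4 * n) * X ^ ((N₀ + 1) * (4 * n))) *
          ((K ^ n * X ^ (N₀ * (Q * n))) * (2 ^ (E + 1) * B / X ^ (E + 1))) := by gcongr
    _ = 2 * 3 ^ (4 * n) * K ^ n * 2 ^ (E + 1) * B *
          ((X ^ ((N₀ + 1) * (4 * n)) * X ^ (N₀ * (Q * n))) / X ^ (E + 1)) := by ring
    _ = 2 * 3 ^ (4 * n) * K ^ n * 2 ^ (E + 1) * B / X := by
        rw [hXE, hquot, div_eq_mul_inv]

/-- **Translation invariance on `⁰𝒮` of the candidate family along a genuine subsequence** (`Tendsto φ atTop atTop`):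
the tree's `translateMulti_apply_eq_of_tendsto` applied to `S_j := Σ_q planeDist_{φ j}` with the lattice vectors
`b_j = a_{φ j} ⌊a / a_{φ j}⌋ → a`; the uniform bound is `UniformFunctionalBoundPlanes` summed over the `6ⁿ` strings,
the asymptotic invariance is the seam estimate `norm_planeDist_translate_sub_le` + `seam_arith`, `o(1)` because
`a_k L_k → ∞`. [folklore] -/
theorem translationPlanes_of_tendsto : ∀ (G : Type) [Group G] [TopologicalSpace G] [IsTopologicalGroup G] [CompactSpace G] [MeasurableSpace G] [BorelSpace G] (r : LatticeRep G) (sch : SpeciesScheme (YMSpecies G)) (φ : ℕ → ℕ) (T : (n : ℕ) → (Fin n → Plane) → (𝓢((Fin n → EuclideanSpace ℝ (Fin 4)), ℂ) →L[ℂ] ℂ)), Tendsto φ atTop atTop → PolyVolume sch → PolyRenorm r sch → UniformFunctionalBoundPlanes r sch → PlaneLimits r sch φ T → ∀ (n : ℕ) (a : EuclideanSpace ℝ (Fin 4)) (F : 𝓢((Fin n → EuclideanSpace ℝ (Fin 4)), ℂ)), IsOffDiagonal F → planeSum T n (translateMulti a F) = planeSum T n F := by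
  intro G _ _ _ _ _ _ r sch φ T hφ hPV hPR hU hPL n a F hF
  -- constants
  obtain ⟨C, hC0, hC⟩ := exists_bound_planeSpecies r
  obtain ⟨A, hA0, hA⟩ := exists_bound_renorm_weight_one r sch hU
  obtain ⟨Q, hQ⟩ := hPR
  obtain ⟨N₀, -, hN₀⟩ := hPV
  obtain ⟨s, α, β, hb⟩ := hU
  -- the sequence of summed plane-string distributions along `φ`
  set S : ℕ → SchwingerFamily (EuclideanSpace ℝ (Fin 4)) := fun j n => ∑ q : Fin n → Plane, planeDist r sch (φ j) n q with hS_def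
  have hSapp : ∀ (j n : ℕ) (F : 𝓢((Fin n → EuclideanSpace ℝ (Fin 4)), ℂ)),
      S j n F = ∑ q : Fin n → Plane, planeDist r sch (φ j) n q F := by
    intro j n F
    simp only [hS_def, FunLike.coe_sum, Finset.sum_apply]
  have h6 : Fintype.card Plane = 6 := by decide
  have hcard : ((Finset.univ : Finset (Fin n → Plane)).card : ℝ) = 6 ^ n := by
    rw [Finset.card_univ, Fintype.card_fun, Fintype.card_fin, h6]
    push_cast
    ring
  -- (hconv) convergence on `⁰𝒮`
  have hconv : ∀ F : 𝓢((Fin n → EuclideanSpace ℝ (Fin 4)), ℂ), IsOffDiagonal F →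
      Tendsto (fun j => S j n F) atTop (𝓝 (planeSum T n F)) := by
    intro F hF
    simp only [hSapp]
    exact hPL.tendsto_planeSum F hF
  -- (hb) the uniform bound, summed over the `6ⁿ` strings
  have hbS : ∀ᶠ j in atTop, ∀ F : 𝓢((Fin n → EuclideanSpace ℝ (Fin 4)), ℂ), IsOffDiagonal F →
      ‖S j n F‖ ≤ (6 ^ n * (α * (n.factorial : ℝ) ^ β)) * schwartzNorm (n * s) F := by
    refine Eventually.of_forall fun j F hF => ?_
    rw [hSapp]
    refine (norm_sum_le _ _).trans ?_
    calc ∑ q : Fin n → Plane, ‖planeDist r sch (φ j) n q F‖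
        ≤ ∑ _q : Fin n → Plane, α * (n.factorial : ℝ) ^ β * schwartzNorm (n * s) F :=
          Finset.sum_le_sum fun q _ => hb n q F hF (φ j)
      _ = (6 ^ n * (α * (n.factorial : ℝ) ^ β)) * schwartzNorm (n * s) F := by
          rw [Finset.sum_const, nsmul_eq_mul, hcard]
          ring
  -- (hba) lattice approximants `b_j = a_{φ j} ⌊a / a_{φ j}⌋ → a`
  have ha0 : Tendsto (fun j => sch.a (φ j)) atTop (𝓝 0) := sch.tendsto_a.comp hφ
  have hXt : Tendsto (fun j => sch.a (φ j) * sch.L (φ j)) atTop atTop := sch.tendsto_L.comp hφ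
  set v : ℕ → Site 4 := fun j l => ⌊a l / sch.a (φ j)⌋ with hv
  set b : ℕ → EuclideanSpace ℝ (Fin 4) := fun j => sch.a (φ j) • siteToE (v j) with hbdef
  have hba : Tendsto b atTop (𝓝 a) := by
    rw [tendsto_iff_norm_sub_tendsto_zero]
    refine squeeze_zero (fun j => norm_nonneg _) (fun j => norm_smul_siteToE_floor_sub_le a (sch.a_pos (φ j))) ?_
    simpa using ha0.const_mul 2
  refine translateMulti_apply_eq_of_tendsto (S := S) (T := planeSum T) hconv hbS hba (fun F' _ => ?_) F hF
  -- (hinv) the seam estimate for `F'`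
  set K : ℝ := 2 * C + A with hK
  have hK0 : 0 ≤ K := by positivity
  set p : ℕ := (N₀ + 1) * (4 * n) + N₀ * (Q * n) + 1 with hp
  set B : ℝ := SchwartzMap.seminorm ℂ p 0 F' with hB
  have hB0 : 0 ≤ B := apply_nonneg _ _
  have hev₁ : ∀ᶠ j in atTop, sch.a (φ j) ≤ 1 := (ha0.eventually (eventually_le_nhds one_pos)).mono fun _ h => h
  have hev₂ : ∀ᶠ j in atTop, max 1 (2 * ‖a‖ + 2) ≤ sch.a (φ j) * sch.L (φ j) := hXt.eventually (eventually_ge_atTop _)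
  have hev₃ : ∀ᶠ j in atTop, (sch.a (φ j))⁻¹ ≤ (sch.a (φ j) * (sch.L (φ j) : ℝ)) ^ N₀ := hφ.eventually hN₀
  have hbound : ∀ᶠ j in atTop, ‖S j n (translateMulti (b j) F') - S j n F'‖ ≤
      6 ^ n * (2 * 3 ^ (4 * n) * K ^ n * 2 ^ p * B / (sch.a (φ j) * sch.L (φ j))) := by
    filter_upwards [hev₁, hev₂, hev₃] with j hj1 hj2 hj3
    have ha' := sch.a_pos (φ j)
    have hX1 : (1 : ℝ) ≤ sch.a (φ j) * sch.L (φ j) := (le_max_left _ _).trans hj2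
    have hXR : 2 * ‖a‖ + 2 ≤ sch.a (φ j) * sch.L (φ j) := (le_max_right _ _).trans hj2
    -- `1 ≤ L`
    have hL1 : 1 ≤ sch.L (φ j) := by
      have h : (1 : ℝ) ≤ sch.L (φ j) := by
        have hL0 : (0 : ℝ) ≤ sch.L (φ j) := Nat.cast_nonneg _
        nlinarith
      exact_mod_cast h
    -- `2‖v_j‖ ≤ L`
    have hvj : 2 * ‖v j‖ ≤ (sch.L (φ j) : ℝ) := by
      have h1 : ‖v j‖ ≤ ‖a‖ / sch.a (φ j) + 1 := norm_floor_le a ha'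
      have h2 : 2 * (‖a‖ / sch.a (φ j) + 1) ≤ sch.L (φ j) := by
        rw [show 2 * (‖a‖ / sch.a (φ j) + 1) = (2 * ‖a‖ + 2 * sch.a (φ j)) / sch.a (φ j) by field_simp,
          div_le_iff₀ ha']
        nlinarith
      linarith
    -- sum the per-string defects
    rw [hSapp, hSapp, ← Finset.sum_sub_distrib]
    refine (norm_sum_le _ _).trans ?_
    calc ∑ q : Fin n → Plane, ‖planeDist r sch (φ j) n q (translateMulti (b j) F') - planeDist r sch (φ j) n q F'‖
        ≤ ∑ _q : Fin n → Plane, 2 * ((2 * sch.L (φ j) + 1 : ℕ) : ℝ) ^ (4 * n) *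
            ((K * (sch.a (φ j))⁻¹ ^ Q) ^ n * (B / (sch.a (φ j) * sch.L (φ j) / 2) ^ p)) :=
          Finset.sum_le_sum fun q _ =>
            norm_planeDist_translate_sub_le r sch hC0 hC hA hQ (φ j) hj1 hL1 (v j) hvj q p F'
      _ = 6 ^ n * (2 * ((2 * sch.L (φ j) + 1 : ℕ) : ℝ) ^ (4 * n) *
            ((K * (sch.a (φ j))⁻¹ ^ Q) ^ n * (B / (sch.a (φ j) * sch.L (φ j) / 2) ^ p))) := by
          rw [Finset.sum_const, nsmul_eq_mul, hcard]
      _ ≤ 6 ^ n * (2 * 3 ^ (4 * n) * K ^ n * 2 ^ p * B / (sch.a (φ j) * sch.L (φ j))) := by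
          gcongr
          exact seam_arith ha' rfl hX1 hj3 hK0 hB0
  refine squeeze_zero_norm' hbound ?_
  have hlim : Tendsto (fun j => 6 ^ n * (2 * 3 ^ (4 * n) * K ^ n * 2 ^ p * B / (sch.a (φ j) * sch.L (φ j))))
      atTop (𝓝 (6 ^ n * 0)) :=
    (tendsto_const_nhds.div_atTop hXt).const_mul _
  simpa using hlim

end Summit.QuantumFields.YangMills.Cruxes.HypercubicLimit.CouplingResponse

end
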